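import Summits.CriticalPhenomena.PercolationContinuityZ3.Theorems.PercNearOneGluingNoHeavyLowerTailKnQuestion8CoefficientwiseStarClass
import HarnessLib

/-!
# NO-CORE(y) ≥ 0 for every vertex `y` adjacent to a point — prim-lf-2 gen 48 (part 2 of the star-class theorem)

Support file (`--supports stmt-CriticalPhenomena-4575`, closed), prover `prim-lf-2` (gen 48).  No definitions, no named facts, no sorries; standard axioms.
Memo `prim-lf-2/CW-HT-gen48.md` §3b.  Part 1: `…KnQuestion8CoefficientwiseStarClass.lean` (`starClass_nonneg_of_pointIndicator`).

Setting.  Finite multigraph `ends : ι → Sym2 V`, root `x`, `K(s) = openCluster (ends '' s) x`; CONJECTURE NO-CORE (prim-lf-2 CW-BOX-gen46): for all monotone `f, g` and every vertex `y`,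
`NO-CORE(y) := Σ_{s : ¬(y ∈ K s ∧ y ∈ K sᶜ)} (f(K s) − f(K sᶜ))(g(K s) − g(K sᶜ)) ≥ 0`.  Known before: `y ∼ x` (gen 46), dominated / dominating positions (gen 47), degree-two `y` with
suitable neighbours (gen 48 `noCore_degTwo_*`).
* `noCore_split_edge` — for any edge `e₀`, NO-CORE(y) is twice its `e₀`-red half (colour swap);
* `noCore_red_half_eq_starClass` — the `e₀`-red half is the star-class sum of part 1 with `D = R = {e₀}` (reindexing the colourings containing `e₀` by the sub-cube `{j // j ∉ {e₀}}`);
* `noCore_adj_point_nonneg` — **THEOREM: if `f = 1[p ∈ ·]` and some edge `e₀` joins `y` to `p ≠ y`, then `NO-CORE(y) ≥ 0` for EVERY monotone `g`, on every finite multigraph,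
  whatever the degree of `y`.**  For the lineage's point functions (`f = 1_u`, `g = 1_w`): CONJECTURE NO-CORE holds at every neighbour of `u` and (by the `f ↔ g` symmetry,
  `noCore_adj_point_nonneg_snd`) at every neighbour of `w`.
Exact pre-checks (prim-lf-2 code/gen48/c/bse.c, deg3.c): the class sums are `≥ 0` in 137.9 M boosted instances (n ≤ 6) and for all degree-3 vertices of all graphs with ≤ 7 vertices
and ≤ 11 edges (1.58 M classes); NO-CORE itself is census-clean through 8 vertices / 12 edges (gen 46).
[cite: KozmaNitzan2024, Questions 8–9 (§5.5 p. 36) (context: the Question-8 pocket covariance programme)]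
-/

namespace Summit.CriticalPhenomena.PercolationContinuityZ3.Theorems

open Finset Literature.Probability.Percolation

namespace Coefficientwise

variable {ι V : Type*} [Fintype ι] [DecidableEq ι] (ends : ι → Sym2 V) (x : V)

open Classical in
/-- **NO-CORE(y) is twice its `e₀`-red half.**  For a swap-symmetric `F` (`F a b = F b a`) and any edge `e₀`:
`Σ_{s : ¬(y∈Ks ∧ y∈Ksᶜ)} F(K s, K sᶜ) = 2·Σ_{s ∋ e₀} [¬(y∈Ks ∧ y∈Ksᶜ)]·F(K s, K sᶜ)`. [cite: KozmaNitzan2024, §5.5 (context only; bookkeeping)] -/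
theorem noCore_split_edge (y : V) (e₀ : ι) (F : Set V → Set V → ℝ) (hF : ∀ a b, F a b = F b a) :
    ∑ s ∈ univ.filter (fun s : Finset ι => ¬ (y ∈ openCluster (ends '' (↑s : Set ι)) x ∧ y ∈ openCluster (ends '' (↑(sᶜ) : Set ι)) x)),
      F (openCluster (ends '' (↑s : Set ι)) x) (openCluster (ends '' (↑(sᶜ) : Set ι)) x) =
    2 * ∑ s ∈ univ.filter (fun s : Finset ι => e₀ ∈ s),
      (if ¬ (y ∈ openCluster (ends '' (↑s : Set ι)) x ∧ y ∈ openCluster (ends '' (↑(sᶜ) : Set ι)) x) then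
        F (openCluster (ends '' (↑s : Set ι)) x) (openCluster (ends '' (↑(sᶜ) : Set ι)) x) else 0) := by
  set K : Finset ι → Set V := fun s => openCluster (ends '' (↑s : Set ι)) x with hK
  set Ψ : Finset ι → ℝ := fun s => if ¬ (y ∈ K s ∧ y ∈ K sᶜ) then F (K s) (K sᶜ) else 0 with hΨ
  change ∑ s ∈ univ.filter (fun s : Finset ι => ¬ (y ∈ K s ∧ y ∈ K sᶜ)), F (K s) (K sᶜ) = 2 * ∑ s ∈ univ.filter (fun s : Finset ι => e₀ ∈ s), Ψ s
  have hΨc : ∀ s : Finset ι, Ψ sᶜ = Ψ s := by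
    intro s
    simp only [hΨ, compl_compl, hF (K sᶜ) (K s)]
    by_cases h1 : y ∈ K s <;> by_cases h2 : y ∈ K sᶜ <;> simp [h1, h2]
  rw [Finset.sum_filter]
  change ∑ s : Finset ι, Ψ s = 2 * ∑ s ∈ univ.filter (fun s : Finset ι => e₀ ∈ s), Ψ s
  rw [← Finset.sum_filter_add_sum_filter_not univ (fun s : Finset ι => e₀ ∈ s) Ψ]
  have hnot : ∑ s ∈ univ.filter (fun s : Finset ι => ¬ e₀ ∈ s), Ψ s = ∑ s ∈ univ.filter (fun s : Finset ι => e₀ ∈ s), Ψ s := by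
    refine Finset.sum_nbij' (fun s => sᶜ) (fun s => sᶜ) ?_ ?_ (fun s _ => compl_compl s) (fun s _ => compl_compl s) (fun s _ => (hΨc s).symm)
    · intro s hs
      exact Finset.mem_filter.mpr ⟨Finset.mem_univ _, Finset.mem_compl.mpr (Finset.mem_filter.mp hs).2⟩
    · intro s hs
      refine Finset.mem_filter.mpr ⟨Finset.mem_univ _, fun h => ?_⟩
      exact (Finset.mem_compl.mp h) (Finset.mem_filter.mp hs).2
  rw [hnot]; ring

open Classical in
/-- **The `e₀`-red half of NO-CORE(y) is the star-class sum with `D = R = {e₀}`** (reindex the colourings containing `e₀` by the sub-cube of the other edges).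
[cite: KozmaNitzan2024, §5.5 (context only; bookkeeping)] -/
theorem noCore_red_half_eq_starClass (y : V) (e₀ : ι) (F : Set V → Set V → ℝ) :
    ∑ s ∈ univ.filter (fun s : Finset ι => e₀ ∈ s),
      (if ¬ (y ∈ openCluster (ends '' (↑s : Set ι)) x ∧ y ∈ openCluster (ends '' (↑(sᶜ) : Set ι)) x) then
        F (openCluster (ends '' (↑s : Set ι)) x) (openCluster (ends '' (↑(sᶜ) : Set ι)) x) else 0) =
    ∑ r : Finset {j : ι // j ∉ ({e₀} : Finset ι)},
      (if ¬ (y ∈ openCluster (ends '' (↑(r.map (Function.Embedding.subtype _) ∪ {e₀}) : Set ι)) x ∧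
              y ∈ openCluster (ends '' (↑(rᶜ.map (Function.Embedding.subtype _) ∪ (({e₀} : Finset ι) \ {e₀})) : Set ι)) x) then
        F (openCluster (ends '' (↑(r.map (Function.Embedding.subtype _) ∪ {e₀}) : Set ι)) x)
          (openCluster (ends '' (↑(rᶜ.map (Function.Embedding.subtype _) ∪ (({e₀} : Finset ι) \ {e₀})) : Set ι)) x)
      else 0) := by
  set K : Finset ι → Set V := fun s => openCluster (ends '' (↑s : Set ι)) x with hK
  set Ψ : Finset ι → ℝ := fun s => if ¬ (y ∈ K s ∧ y ∈ K sᶜ) then F (K s) (K sᶜ) else 0 with hΨ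
  set Pr : ι → Prop := fun j => j ∉ ({e₀} : Finset ι) with hPr
  set emb := Function.Embedding.subtype Pr with hemb
  set jj : Finset {j : ι // Pr j} → Finset ι := fun r => r.map emb ∪ {e₀} with hjj
  have he₀r : ∀ r : Finset {j : ι // Pr j}, e₀ ∉ r.map emb := fun r h => by
    obtain ⟨b, _, hb⟩ := Finset.mem_map.mp h
    exact b.2 (by rw [← hb]; exact Finset.mem_singleton_self _)
  have hcompl : ∀ r : Finset {j : ι // Pr j}, (jj r)ᶜ = rᶜ.map emb ∪ (({e₀} : Finset ι) \ {e₀}) := by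
    intro r
    rw [Finset.sdiff_self, Finset.union_empty]
    ext a
    rw [Finset.mem_compl, hjj, Finset.mem_union, Finset.mem_singleton]
    constructor
    · intro h
      have ha : a ≠ e₀ := fun hae => h (Or.inr hae)
      have hPa : Pr a := by simpa [hPr] using ha
      refine Finset.mem_map.mpr ⟨⟨a, hPa⟩, ?_, rfl⟩
      rw [Finset.mem_compl]
      intro har
      exact h (Or.inl (Finset.mem_map.mpr ⟨⟨a, hPa⟩, har, rfl⟩))
    · intro h h'
      obtain ⟨b, hb, hba⟩ := Finset.mem_map.mp h
      rcases h' with h' | h'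
      · obtain ⟨c, hc, hca⟩ := Finset.mem_map.mp h'
        have : b = c := Subtype.ext (by rw [show (b : ι) = a from hba, show (c : ι) = a from hca])
        exact (Finset.mem_compl.mp hb) (this ▸ hc)
      · exact b.2 (by rw [show (b : ι) = a from hba, h']; exact Finset.mem_singleton_self _)
  change ∑ s ∈ univ.filter (fun s : Finset ι => e₀ ∈ s), Ψ s = ∑ r : Finset {j : ι // Pr j},
    (if ¬ (y ∈ K (jj r) ∧ y ∈ K (rᶜ.map emb ∪ (({e₀} : Finset ι) \ {e₀}))) then F (K (jj r)) (K (rᶜ.map emb ∪ (({e₀} : Finset ι) \ {e₀}))) else 0)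
  have hrhs : ∀ r : Finset {j : ι // Pr j},
      (if ¬ (y ∈ K (jj r) ∧ y ∈ K (rᶜ.map emb ∪ (({e₀} : Finset ι) \ {e₀}))) then F (K (jj r)) (K (rᶜ.map emb ∪ (({e₀} : Finset ι) \ {e₀}))) else 0) = Ψ (jj r) := by
    intro r; simp only [hΨ, hcompl r]
  rw [Finset.sum_congr rfl (fun r _ => hrhs r)]
  have hleft : ∀ s ∈ univ.filter (fun s : Finset ι => e₀ ∈ s), jj (s.subtype Pr) = s := by
    intro s hs
    have hs' : e₀ ∈ s := (Finset.mem_filter.mp hs).2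
    rw [hjj]; simp only [hemb, Finset.subtype_map]
    ext a
    simp only [Finset.mem_union, Finset.mem_filter, Finset.mem_singleton, hPr]
    constructor
    · rintro (⟨ha, _⟩ | rfl); exact ha; exact hs'
    · intro ha; by_cases hae : a = e₀; exact Or.inr hae; exact Or.inl ⟨ha, hae⟩
  refine Finset.sum_nbij' (fun s => s.subtype Pr) jj ?_ ?_ hleft ?_ ?_
  · intro s _; exact Finset.mem_univ _
  · intro r _; exact Finset.mem_filter.mpr ⟨Finset.mem_univ _, by rw [hjj]; exact Finset.mem_union_right _ (Finset.mem_singleton_self _)⟩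
  · intro r _
    ext a
    rw [Finset.mem_subtype, hjj, Finset.mem_union, Finset.mem_singleton]
    constructor
    · rintro (ha | ha)
      · obtain ⟨b, hb, hba⟩ := Finset.mem_map.mp ha
        have : b = a := Subtype.ext hba
        exact this ▸ hb
      · exact absurd (by rw [ha]; exact Finset.mem_singleton_self _) a.2
    · intro ha; exact Or.inl (Finset.mem_map.mpr ⟨a, ha, rfl⟩)
  · intro s hs; rw [hleft s hs]

open Classical in
/-- **THEOREM: NO-CORE(y) ≥ 0 for every vertex `y` adjacent to the point.**  If `f = 1[p ∈ ·]` and some edge `e₀` joins `y` to `p ≠ y`, then for every monotone `g`: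
`0 ≤ Σ_{s : ¬(y ∈ K s ∧ y ∈ K sᶜ)} ([p ∈ K s] − [p ∈ K sᶜ])·(g(K s) − g(K sᶜ))` — any degree of `y`, any finite multigraph.  (NO-CORE = 2 × the `e₀`-red half
(`noCore_split_edge`), the half is the star class `D = R = {e₀}` (`noCore_red_half_eq_starClass`), which is `≥ 0` by `starClass_nonneg_of_pointIndicator`.)
[cite: KozmaNitzan2024, Questions 8–9 (§5.5 p. 36) (context)] -/
theorem noCore_adj_point_nonneg (y p : V) {e₀ : ι} (he₀ : ends e₀ = s(y, p)) (hpy : p ≠ y) (g : Set V → ℝ) (hg : Monotone g) :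
    0 ≤ ∑ s ∈ univ.filter (fun s : Finset ι => ¬ (y ∈ openCluster (ends '' (↑s : Set ι)) x ∧ y ∈ openCluster (ends '' (↑(sᶜ) : Set ι)) x)),
      ((if p ∈ openCluster (ends '' (↑s : Set ι)) x then (1 : ℝ) else 0) - (if p ∈ openCluster (ends '' (↑(sᶜ) : Set ι)) x then (1 : ℝ) else 0)) *
        (g (openCluster (ends '' (↑s : Set ι)) x) - g (openCluster (ends '' (↑(sᶜ) : Set ι)) x)) := by
  have h1 := noCore_split_edge ends x y e₀ (fun a b => ((if p ∈ a then (1 : ℝ) else 0) - (if p ∈ b then (1 : ℝ) else 0)) * (g a - g b)) (fun a b => by ring)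
  have h2 := noCore_red_half_eq_starClass ends x y e₀ (fun a b => ((if p ∈ a then (1 : ℝ) else 0) - (if p ∈ b then (1 : ℝ) else 0)) * (g a - g b))
  have h := starClass_nonneg_of_pointIndicator ends x ({e₀} : Finset ι) ({e₀} : Finset ι) (le_refl _)
    (fun i hi => by rw [Finset.mem_singleton.mp hi, he₀]; exact Sym2.mem_mk_left _ _) he₀ hpy (Finset.mem_singleton_self _) g hg
  beta_reduce at h1 h2
  rw [h1, h2]
  linarith

open Classical in
/-- The same with the roles of the two functions exchanged: `NO-CORE(y) ≥ 0` for monotone `f` and `g = 1[p ∈ ·]`, `y ∼ p`.  For the points `u, w`: CONJECTURE NO-CORE holds at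
every neighbour of `u` and at every neighbour of `w`. [cite: KozmaNitzan2024, Questions 8–9 (§5.5 p. 36) (context)] -/
theorem noCore_adj_point_nonneg_snd (y p : V) {e₀ : ι} (he₀ : ends e₀ = s(y, p)) (hpy : p ≠ y) (f : Set V → ℝ) (hf : Monotone f) :
    0 ≤ ∑ s ∈ univ.filter (fun s : Finset ι => ¬ (y ∈ openCluster (ends '' (↑s : Set ι)) x ∧ y ∈ openCluster (ends '' (↑(sᶜ) : Set ι)) x)),
      (f (openCluster (ends '' (↑s : Set ι)) x) - f (openCluster (ends '' (↑(sᶜ) : Set ι)) x)) *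
        ((if p ∈ openCluster (ends '' (↑s : Set ι)) x then (1 : ℝ) else 0) - (if p ∈ openCluster (ends '' (↑(sᶜ) : Set ι)) x then (1 : ℝ) else 0)) := by
  have hcomm := Finset.sum_congr (rfl : univ.filter (fun s : Finset ι => ¬ (y ∈ openCluster (ends '' (↑s : Set ι)) x ∧ y ∈ openCluster (ends '' (↑(sᶜ) : Set ι)) x)) = _)
    (fun s _ => mul_comm
      (f (openCluster (ends '' (↑s : Set ι)) x) - f (openCluster (ends '' (↑(sᶜ) : Set ι)) x))
      ((if p ∈ openCluster (ends '' (↑s : Set ι)) x then (1 : ℝ) else 0) - (if p ∈ openCluster (ends '' (↑(sᶜ) : Set ι)) x then (1 : ℝ) else 0)))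
  rw [hcomm]
  exact noCore_adj_point_nonneg ends x y p he₀ hpy f hf

end Coefficientwise

end Summit.CriticalPhenomena.PercolationContinuityZ3.Theorems
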